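import Summits.KontsevichZagierPeriods.KontsevichZagierPeriods.Theorems.HurwitzMicroSectorsHurwitzSectorComplementStubLadderEngineAux
import Summits.KontsevichZagierPeriods.KontsevichZagierPeriods.Theorems.LinRedNormalFormArrangementNormalFormStubIntegrateOutMoves

/-!
# `HurwitzSectorComplement` (stmt-KontsevichZagierPeriods-14341, route HurwitzMicroSectors),
# line `chebyshev-level-deformation`: stub `stub_ladderEngine` (S1) — stage domains

Geometry of the stage domains `S n j V ⊆ ℝ^{n+j}` of the Chebyshev ladder (box coordinates
`z (Fin.castAdd j i) ∈ (0,1)` first, then a strictly decreasing positive parameter chain capped by the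
real algebraic number `V`): `ℚ`-semialgebraicity of the domains, of the kernel parameter `κ`, of the
weight `Ω = ∏ g(vᵢ)` and of the product `P` of the box coordinates; the chain-extension identity;
the box and simplex factors as integral representations and, by Tonelli (`KZ.IntegralRep.prod`),
absolute integrability of `Ω/(1 − P)` on `S (m+2) j V`. All symbols enter as quantified functions
with defining equations. Reference: M. Kontsevich, D. Zagier, *Periods* (2001), §1.1–1.2.
-/

noncomputable section

open Set MeasureTheory
open scoped BigOperators ENNReal
open Literature.NumberTheory.Transcendental

namespace Summit.KontsevichZagierPeriods.Theorems.HurwitzMicroSectorsHurwitzSectorComplement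

namespace LadderEngine

open Literature.ModelTheory.ExponentialFields (IsSemialgebraic)
open Summit.KontsevichZagierPeriods.ArrangementNormalForm.JanusBands.IntegrateOut
  (isSemialgebraicFunOn_finset_prod)

/-! ### Strict inequalities, chains -/

/-- Strict inequalities between semialgebraic functions cut out semialgebraic sets
(graph elimination). [cite: BochnakCosteRoy1998, Prop. 2.2.6] -/
theorem isSemialgebraic_sep_lt' {N : ℕ} {σ : Set (Fin N → ℝ)} {u v : (Fin N → ℝ) → ℝ}
    (hu : IsSemialgebraicFunOn ℚ σ u) (hv : IsSemialgebraicFunOn ℚ σ v) :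
    IsSemialgebraic ℚ {x | x ∈ σ ∧ u x < v x} := by
  have h := (IsSemialgebraicFunOn.sub_holds hu hv).isSemialgebraic_sep_neg
  convert h using 1
  ext x
  simp [sub_neg]

/-- The components of the parameter chain `Fin.cons V (z ∘ ρ)` are semialgebraic functions when
the cap `V` is real algebraic (`ℚ`-definable). [cite: KontsevichZagier2001, §1.1] -/
theorem sa_chain {N j : ℕ} {V : ℝ} (hV : IsAlgebraic ℚ V) (ρ : Fin j → Fin N)
    {σ : Set (Fin N → ℝ)} (hσ : IsSemialgebraic ℚ σ) (a : Fin (j + 1)) :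
    IsSemialgebraicFunOn ℚ σ
      (fun z => (Fin.cons V (fun i : Fin j => z (ρ i)) : Fin (j + 1) → ℝ) a) := by
  induction a using Fin.cases with
  | zero => simpa using isSemialgebraicFunOn_const_of_isAlgebraic hσ hV
  | succ i => simpa using isSemialgebraicFunOn_apply hσ (ρ i)

/-- The chain conditions `StrictAnti (V, z_{ρ 0}, …, z_{ρ (j−1)})` and `0 <` last entry cut out a
`ℚ`-semialgebraic set. [cite: KontsevichZagier2001, §1.1] -/
theorem isSemialgebraic_chainSet {N j : ℕ} {V : ℝ} (hV : IsAlgebraic ℚ V) (ρ : Fin j → Fin N) :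
    IsSemialgebraic ℚ {z : Fin N → ℝ |
      StrictAnti (Fin.cons V (fun i : Fin j => z (ρ i)) : Fin (j + 1) → ℝ) ∧
      0 < (Fin.cons V (fun i : Fin j => z (ρ i)) : Fin (j + 1) → ℝ) (Fin.last j)} := by
  have hU : IsSemialgebraic ℚ (univ : Set (Fin N → ℝ)) :=
    Literature.ModelTheory.ExponentialFields.isSemialgebraic_univ
  have hanti : IsSemialgebraic ℚ {z : Fin N → ℝ |
      StrictAnti (Fin.cons V (fun i : Fin j => z (ρ i)) : Fin (j + 1) → ℝ)} := by
    have hset : {z : Fin N → ℝ |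
        StrictAnti (Fin.cons V (fun i : Fin j => z (ρ i)) : Fin (j + 1) → ℝ)} =
        ⋂ a ∈ (Finset.univ : Finset (Fin (j + 1))), ⋂ b ∈ (Finset.univ : Finset (Fin (j + 1))),
          (if a < b then {z : Fin N → ℝ | z ∈ univ ∧
            (Fin.cons V (fun i : Fin j => z (ρ i)) : Fin (j + 1) → ℝ) b <
              (Fin.cons V (fun i : Fin j => z (ρ i)) : Fin (j + 1) → ℝ) a} else univ) := by
      ext z
      simp only [mem_setOf_eq, Finset.mem_univ, iInter_true, mem_iInter]
      constructor
      · intro h a b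
        split_ifs with hab
        · exact ⟨trivial, h hab⟩
        · trivial
      · intro h a b hab
        have := h a b
        rw [if_pos hab] at this
        exact this.2
    rw [hset]
    refine IsSemialgebraic.biInter _ _ fun a _ => IsSemialgebraic.biInter _ _ fun b _ => ?_
    split_ifs
    · exact isSemialgebraic_sep_lt' (sa_chain hV ρ hU b) (sa_chain hV ρ hU a)
    · exact hU
  have hlast : IsSemialgebraic ℚ {z : Fin N → ℝ | z ∈ univ ∧
      (0 : ℝ) < (Fin.cons V (fun i : Fin j => z (ρ i)) : Fin (j + 1) → ℝ) (Fin.last j)} :=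
    isSemialgebraic_sep_lt' (by simpa using isSemialgebraicFunOn_ratCast hU 0)
      (sa_chain hV ρ hU (Fin.last j))
  convert hanti.inter hlast using 1
  ext z
  simp

/-- The open unit box `{x | ∀ i, x i ∈ (0,1)} ⊆ ℝᴺ` is `ℚ`-semialgebraic. [folklore] -/
theorem isSemialgebraic_box (N : ℕ) : IsSemialgebraic ℚ {x : Fin N → ℝ | ∀ i, x i ∈ Ioo (0 : ℝ) 1} := by
  have hset : {x : Fin N → ℝ | ∀ i, x i ∈ Ioo (0 : ℝ) 1} = ⋂ i ∈ (Finset.univ : Finset (Fin N)),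
      ({x | 0 < MvPolynomial.aeval x (MvPolynomial.X i : MvPolynomial (Fin N) ℚ)} ∩
        {x | 0 < MvPolynomial.aeval x
          (MvPolynomial.C 1 - MvPolynomial.X i : MvPolynomial (Fin N) ℚ)}) := by
    ext x
    simp [sub_pos]
  rw [hset]
  exact IsSemialgebraic.biInter _ _ fun i _ =>
    (Literature.ModelTheory.ExponentialFields.isSemialgebraic_setOf_eval_pos _).inter
      (Literature.ModelTheory.ExponentialFields.isSemialgebraic_setOf_eval_pos _)

/-- Extending a strictly decreasing chain by one entry at the end. [folklore] -/
theorem strictAnti_snoc_iff {k : ℕ} (c : Fin (k + 1) → ℝ) (t : ℝ) :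
    StrictAnti (Fin.snoc c t : Fin (k + 2) → ℝ) ↔ StrictAnti c ∧ t < c (Fin.last k) := by
  rw [Fin.strictAnti_iff_succ_lt, Fin.strictAnti_iff_succ_lt, Fin.forall_fin_succ']
  simp only [Fin.succ_last, Fin.snoc_last, Fin.succ_castSucc, Fin.snoc_castSucc]

/-- The chain of `j + 1` parameters is the chain of the first `j` parameters extended by the last
one. [folklore] -/
theorem cons_eq_snoc {N j : ℕ} (V : ℝ) (ρ : Fin (j + 1) → Fin N) (y : Fin N → ℝ) :
    (Fin.cons V (fun i : Fin (j + 1) => y (ρ i)) : Fin (j + 2) → ℝ) =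
      Fin.snoc (Fin.cons V (fun i : Fin j => y (ρ (Fin.castSucc i))) : Fin (j + 1) → ℝ)
        (y (ρ (Fin.last j))) := by
  rw [← Fin.cons_snoc_eq_snoc_cons]
  congr 1
  exact (Fin.snoc_init_self _).symm

/-! ### The stage domains -/

section Stage

variable {g : ℝ → ℝ} {S : (n j : ℕ) → ℝ → Set (Fin (n + j) → ℝ)}
  {Ω P : (n j : ℕ) → (Fin (n + j) → ℝ) → ℝ} {κ : (n j : ℕ) → ℝ → (Fin (n + j) → ℝ) → ℝ}

/-- **The stage domains are `ℚ`-semialgebraic** (box: polynomial inequalities; chain: comparisons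
of coordinates and of the `ℚ`-definable constant `V`). [cite: KontsevichZagier2001, §1.1] -/
theorem isSemialgebraic_S
    (hS : ∀ n j V z, z ∈ S n j V ↔ (∀ i : Fin n, z (Fin.castAdd j i) ∈ Set.Ioo (0:ℝ) 1) ∧
      StrictAnti (Fin.cons V (fun i : Fin j => z (Fin.natAdd n i)) : Fin (j + 1) → ℝ) ∧
      0 < (Fin.cons V (fun i : Fin j => z (Fin.natAdd n i)) : Fin (j + 1) → ℝ) (Fin.last j))
    {V : ℝ} (hV : IsAlgebraic ℚ V) (n j : ℕ) : IsSemialgebraic ℚ (S n j V) := by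
  have hbox : IsSemialgebraic ℚ {z : Fin (n + j) → ℝ | ∀ i : Fin n, z (Fin.castAdd j i) ∈ Ioo (0:ℝ) 1} :=
    (isSemialgebraic_box n).preimage_comp (Fin.castAdd j)
  have hset : S n j V = {z : Fin (n + j) → ℝ | ∀ i : Fin n, z (Fin.castAdd j i) ∈ Ioo (0:ℝ) 1} ∩
      {z | StrictAnti (Fin.cons V (fun i : Fin j => z (Fin.natAdd n i)) : Fin (j + 1) → ℝ) ∧
        0 < (Fin.cons V (fun i : Fin j => z (Fin.natAdd n i)) : Fin (j + 1) → ℝ) (Fin.last j)} := by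
    ext z
    rw [hS]
    rfl
  rw [hset]
  exact hbox.inter (isSemialgebraic_chainSet hV (Fin.natAdd n))

/-- The stage domains are Lebesgue measurable. [folklore] -/
theorem measurableSet_S
    (hS : ∀ n j V z, z ∈ S n j V ↔ (∀ i : Fin n, z (Fin.castAdd j i) ∈ Set.Ioo (0:ℝ) 1) ∧
      StrictAnti (Fin.cons V (fun i : Fin j => z (Fin.natAdd n i)) : Fin (j + 1) → ℝ) ∧
      0 < (Fin.cons V (fun i : Fin j => z (Fin.natAdd n i)) : Fin (j + 1) → ℝ) (Fin.last j))
    {V : ℝ} (hV : IsAlgebraic ℚ V) (n j : ℕ) : MeasurableSet (S n j V) :=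
  IsSemialgebraic.measurableSet_holds (isSemialgebraic_S hS hV n j)

/-- The kernel parameter `κ` (last chain entry) is a semialgebraic function.
[cite: KontsevichZagier2001, §1.1] -/
theorem sa_κ
    (hκ : ∀ n j V z, κ n j V z = (Fin.cons V (fun i : Fin j => z (Fin.natAdd n i)) :
      Fin (j + 1) → ℝ) (Fin.last j))
    {V : ℝ} (hV : IsAlgebraic ℚ V) (n j : ℕ) {σ : Set (Fin (n + j) → ℝ)} (hσ : IsSemialgebraic ℚ σ) :
    IsSemialgebraicFunOn ℚ σ (κ n j V) :=
  (sa_chain hV (Fin.natAdd n) hσ (Fin.last j)).congr fun z _ => (hκ n j V z).symm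

/-- The weight `Ω = ∏ g(vᵢ)` is a semialgebraic function. [cite: BochnakCosteRoy1998, Prop. 2.2.6] -/
theorem sa_Ω (hg : ∀ v, g v = 2 / (1 + v ^ 2))
    (hΩ : ∀ n j z, Ω n j z = ∏ i : Fin j, g (z (Fin.natAdd n i))) (n j : ℕ)
    {σ : Set (Fin (n + j) → ℝ)} (hσ : IsSemialgebraic ℚ σ) : IsSemialgebraicFunOn ℚ σ (Ω n j) :=
  (isSemialgebraicFunOn_finset_prod Finset.univ hσ fun i _ =>
    sa_g hg hσ (isSemialgebraicFunOn_apply hσ (Fin.natAdd n i))).congr fun z _ => (hΩ n j z).symm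

/-- The product `P` of the box coordinates is a semialgebraic (polynomial) function.
[cite: BochnakCosteRoy1998, §2.2] -/
theorem sa_P (hP : ∀ n j z, P n j z = ∏ i : Fin n, z (Fin.castAdd j i)) (n j : ℕ)
    {σ : Set (Fin (n + j) → ℝ)} (hσ : IsSemialgebraic ℚ σ) : IsSemialgebraicFunOn ℚ σ (P n j) :=
  (isSemialgebraicFunOn_finset_prod Finset.univ hσ fun i _ =>
    isSemialgebraicFunOn_apply hσ (Fin.castAdd j i)).congr fun z _ => (hP n j z).symm

/-- `0 < g ≤ 2`. [folklore] -/
theorem g_pos_le (hg : ∀ v, g v = 2 / (1 + v ^ 2)) (v : ℝ) : 0 < g v ∧ g v ≤ 2 := by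
  rw [hg]
  refine ⟨by positivity, ?_⟩
  rw [div_le_iff₀ (by positivity)]
  nlinarith [sq_nonneg v]

/-- `0 ≤ Ω ≤ 2^j`. [folklore] -/
theorem Ω_nonneg_le (hg : ∀ v, g v = 2 / (1 + v ^ 2))
    (hΩ : ∀ n j z, Ω n j z = ∏ i : Fin j, g (z (Fin.natAdd n i))) (n j : ℕ)
    (z : Fin (n + j) → ℝ) : 0 ≤ Ω n j z ∧ Ω n j z ≤ 2 ^ j := by
  rw [hΩ]
  refine ⟨Finset.prod_nonneg fun i _ => (g_pos_le hg _).1.le, ?_⟩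
  calc ∏ i : Fin j, g (z (Fin.natAdd n i)) ≤ ∏ _i : Fin j, (2 : ℝ) :=
        Finset.prod_le_prod (fun i _ => (g_pos_le hg _).1.le) fun i _ => (g_pos_le hg _).2
    _ = 2 ^ j := by simp

/-- On a stage domain with `n ≥ 1` box coordinates, `P ∈ (0,1)`. [folklore] -/
theorem P_mem_Ioo
    (hS : ∀ n j V z, z ∈ S n j V ↔ (∀ i : Fin n, z (Fin.castAdd j i) ∈ Set.Ioo (0:ℝ) 1) ∧
      StrictAnti (Fin.cons V (fun i : Fin j => z (Fin.natAdd n i)) : Fin (j + 1) → ℝ) ∧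
      0 < (Fin.cons V (fun i : Fin j => z (Fin.natAdd n i)) : Fin (j + 1) → ℝ) (Fin.last j))
    (hP : ∀ n j z, P n j z = ∏ i : Fin n, z (Fin.castAdd j i)) {n j : ℕ} (hn : n ≠ 0) {V : ℝ}
    {z : Fin (n + j) → ℝ} (hz : z ∈ S n j V) : P n j z ∈ Ioo (0 : ℝ) 1 := by
  rw [hP]
  exact BoxIntegral.prod_mem_Ioo hn (x := fun i => z (Fin.castAdd j i)) ((hS n j V z).1 hz).1

/-- On a stage domain the kernel parameter is positive. [folklore] -/
theorem κ_pos
    (hS : ∀ n j V z, z ∈ S n j V ↔ (∀ i : Fin n, z (Fin.castAdd j i) ∈ Set.Ioo (0:ℝ) 1) ∧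
      StrictAnti (Fin.cons V (fun i : Fin j => z (Fin.natAdd n i)) : Fin (j + 1) → ℝ) ∧
      0 < (Fin.cons V (fun i : Fin j => z (Fin.natAdd n i)) : Fin (j + 1) → ℝ) (Fin.last j))
    (hκ : ∀ n j V z, κ n j V z = (Fin.cons V (fun i : Fin j => z (Fin.natAdd n i)) :
      Fin (j + 1) → ℝ) (Fin.last j))
    {n j : ℕ} {V : ℝ} {z : Fin (n + j) → ℝ} (hz : z ∈ S n j V) : 0 < κ n j V z := by
  rw [hκ]
  exact ((hS n j V z).1 hz).2.2

/-! ### The box and simplex factors; integrability of `Ω/(1 − P)` -/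

/-- The box factor `[(0,1)^{m+2}, 1/(1 − ∏ xᵢ)]` is an integral representation
(`BoxIntegral.integrableOn_box_one_div_one_sub_prod`). [cite: KontsevichZagier2001, §1.1] -/
theorem exists_boxRep (m : ℕ) : ∃ b : KZ.IntegralRep (m + 2),
    b.domain = {x | ∀ i, x i ∈ Ioo (0 : ℝ) 1} ∧ b.integrand = fun x => 1 / (1 - ∏ i, x i) := by
  have hσ := isSemialgebraic_box (m + 2)
  have h1 : IsSemialgebraicFunOn ℚ {x : Fin (m + 2) → ℝ | ∀ i, x i ∈ Ioo (0 : ℝ) 1}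
      (fun _ => (1 : ℝ)) := by
    simpa using isSemialgebraicFunOn_ratCast hσ 1
  refine ⟨⟨_, _, hσ, h1.div (sa_sub h1 (isSemialgebraicFunOn_finset_prod Finset.univ hσ fun i _ =>
    isSemialgebraicFunOn_apply hσ i)) fun x hx => ?_,
    BoxIntegral.integrableOn_box_one_div_one_sub_prod (by omega)⟩, rfl, rfl⟩
  exact (sub_pos.2 (BoxIntegral.prod_mem_Ioo (by omega) hx).2).ne'

/-- The simplex factor `[Δ_j(V), ∏ g(vᵢ)]` (`Δ_j(V)`: chains `V > v₀ > ⋯ > v_{j−1} > 0`) is an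
integral representation: bounded integrand on a bounded `ℚ`-semialgebraic domain.
[cite: KontsevichZagier2001, §1.1] -/
theorem exists_simplexRep (hg : ∀ v, g v = 2 / (1 + v ^ 2)) {V : ℝ} (hV : IsAlgebraic ℚ V) (j : ℕ) :
    ∃ s : KZ.IntegralRep j,
      s.domain = {v | StrictAnti (Fin.cons V (fun i : Fin j => v i) : Fin (j + 1) → ℝ) ∧
        0 < (Fin.cons V (fun i : Fin j => v i) : Fin (j + 1) → ℝ) (Fin.last j)} ∧
      s.integrand = fun v => ∏ i, g (v i) := by
  have hσ := isSemialgebraic_chainSet (N := j) hV id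
  simp only [id_eq] at hσ
  have hf : IsSemialgebraicFunOn ℚ _ (fun v : Fin j → ℝ => ∏ i, g (v i)) :=
    isSemialgebraicFunOn_finset_prod Finset.univ hσ fun i _ => sa_g hg hσ (isSemialgebraicFunOn_apply hσ i)
  have hmeas : MeasurableSet {v : Fin j → ℝ | StrictAnti (Fin.cons V (fun i : Fin j => v i) :
      Fin (j + 1) → ℝ) ∧ 0 < (Fin.cons V (fun i : Fin j => v i) : Fin (j + 1) → ℝ) (Fin.last j)} :=
    IsSemialgebraic.measurableSet_holds hσ
  have hsub : {v : Fin j → ℝ | StrictAnti (Fin.cons V (fun i : Fin j => v i) : Fin (j + 1) → ℝ) ∧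
      0 < (Fin.cons V (fun i : Fin j => v i) : Fin (j + 1) → ℝ) (Fin.last j)} ⊆
      Set.pi univ fun _ => Icc 0 V := by
    intro v hv i _
    obtain ⟨hanti, hlast⟩ := hv
    have h1 : (Fin.cons V (fun i : Fin j => v i) : Fin (j + 1) → ℝ) (Fin.succ i) ≤
        (Fin.cons V (fun i : Fin j => v i) : Fin (j + 1) → ℝ) 0 :=
      hanti.antitone (Fin.zero_le _)
    have h2 : (Fin.cons V (fun i : Fin j => v i) : Fin (j + 1) → ℝ) (Fin.last j) ≤
        (Fin.cons V (fun i : Fin j => v i) : Fin (j + 1) → ℝ) (Fin.succ i) :=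
      hanti.antitone (Fin.le_last _)
    simp only [Fin.cons_succ, Fin.cons_zero] at h1 h2
    exact ⟨by linarith, h1⟩
  have hvol : volume {v : Fin j → ℝ | StrictAnti (Fin.cons V (fun i : Fin j => v i) :
      Fin (j + 1) → ℝ) ∧ 0 < (Fin.cons V (fun i : Fin j => v i) : Fin (j + 1) → ℝ) (Fin.last j)} < ⊤ := by
    refine (measure_mono hsub).trans_lt ?_
    rw [volume_pi_pi]
    simp [Real.volume_Icc]
  refine ⟨⟨_, _, hσ, hf, ?_⟩, rfl, rfl⟩
  refine ⟨KZ.aestronglyMeasurable_of_isSemialgebraicFunOn hf hmeas,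
    HasFiniteIntegral.restrict_of_bounded (C := 2 ^ j) hvol ?_⟩
  refine (ae_restrict_mem hmeas).mono fun v _ => ?_
  rw [Real.norm_eq_abs, abs_of_nonneg (Finset.prod_nonneg fun i _ => (g_pos_le hg _).1.le)]
  calc ∏ i : Fin j, g (v i) ≤ ∏ _i : Fin j, (2 : ℝ) :=
        Finset.prod_le_prod (fun i _ => (g_pos_le hg _).1.le) fun i _ => (g_pos_le hg _).2
    _ = 2 ^ j := by simp

/-- **`Ω/(1 − P)` is absolutely integrable on `S (m+2) j V`** (Tonelli for the product of the box
factor and the simplex factor, `KZ.IntegralRep.integrableOn_prodFun`). [cite: KontsevichZagier2001, §4.1] -/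
theorem integrableOn_Ω_div (hg : ∀ v, g v = 2 / (1 + v ^ 2))
    (hS : ∀ n j V z, z ∈ S n j V ↔ (∀ i : Fin n, z (Fin.castAdd j i) ∈ Set.Ioo (0:ℝ) 1) ∧
      StrictAnti (Fin.cons V (fun i : Fin j => z (Fin.natAdd n i)) : Fin (j + 1) → ℝ) ∧
      0 < (Fin.cons V (fun i : Fin j => z (Fin.natAdd n i)) : Fin (j + 1) → ℝ) (Fin.last j))
    (hΩ : ∀ n j z, Ω n j z = ∏ i : Fin j, g (z (Fin.natAdd n i)))
    (hP : ∀ n j z, P n j z = ∏ i : Fin n, z (Fin.castAdd j i)) {V : ℝ} (hV : IsAlgebraic ℚ V)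
    (m j : ℕ) : IntegrableOn (fun z => Ω (m + 2) j z / (1 - P (m + 2) j z)) (S (m + 2) j V) := by
  obtain ⟨b, hbd, hbi⟩ := exists_boxRep m
  obtain ⟨s, hsd, hsi⟩ := exists_simplexRep hg hV j
  have h := KZ.IntegralRep.integrableOn_prodFun b s
  have hdom : KZ.IntegralRep.prodDomain b s = S (m + 2) j V := by
    ext z
    rw [KZ.IntegralRep.mem_prodDomain, hbd, hsd, hS]
    simp only [mem_setOf_eq]
  have hfun : KZ.IntegralRep.prodFun b s = fun z => Ω (m + 2) j z / (1 - P (m + 2) j z) := by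
    funext z
    rw [KZ.IntegralRep.prodFun_apply, hbi, hsi, hΩ, hP]
    simp only
    ring
  rwa [hdom, hfun] at h

end Stage

end LadderEngine

/-- **Anchor of this helper file (registered sub-goal): extending a strictly decreasing chain.**
[folklore] -/
theorem ladderEngine_snocChain : ∀ (k : ℕ) (c : Fin (k + 1) → ℝ) (t : ℝ), StrictAnti (Fin.snoc c t : Fin (k + 2) → ℝ) ↔ StrictAnti c ∧ t < c (Fin.last k) :=
  fun _ c t => LadderEngine.strictAnti_snoc_iff c t

end Summit.KontsevichZagierPeriods.Theorems.HurwitzMicroSectorsHurwitzSectorComplement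

end
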